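import Literature.Probability.Percolation.TwoGhostInequalityProofs
import Mathlib.Analysis.SumIntegralComparisons
import Mathlib.Analysis.SpecialFunctions.Integrals.Basic
import HarnessLib

/-!
# The exploration second moment with the one-arm tail kept (two-ghost ⊗ a-priori tail, part 1)

Crux `Summit.CriticalPhenomena.PercolationContinuityZ3.Theses.PercMinContact.MinContactExponent`
(item stmt-CriticalPhenomena-11498), line `registered` (`Cruxes/MinContactExponent/Lines/birth.lean`),
helper of the lead (prover-line-stmt-CriticalPhenomena-11498-c3-0), `--supports stmt-CriticalPhenomena-11498`.

The line's stub A `stub_condTwoGhost` asks that Hutchcroft's two-ghost exponent `n^{-1/2}` survive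
conditioning on the volume of one of the two clusters. The tree's proof of the two-ghost inequality
(`TwoGhostInequalityProofs`, Hutchcroft 2020 Cor. 1.7) bounds the second moment of the exploration
martingale by `E[Z_N²] ≤ p(1-p)N`; but the tree also has the EXACT formula
`E[Z_N²] = p(1-p) Σ_{k<N} P(not halted at k)` (`ClusterExploration.integral_score_sq_eq`), and "not halted
after `k` queries" forces the cluster to touch more than `k` edges. Keeping this one-arm information is
exactly the mechanism of Hutchcroft's two-ghost inequality WITH AN A-PRIORI VOLUME TAIL (arXiv:2008.11197,
Thm. 3.1, stated there for long-range models). This file (part 1 of 2) proves: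

* `TwoGhostTail.succ_le_encard_touch_of_not_halted` — not halted after `k` steps ⇒ `|E(C(o))| ≥ k+1`;
* `TwoGhostTail.lintegral_sq_hp_le_sum` — `E[h_p(C(x))²; C(x) finite, |E(C(x))| ≤ N] ≤ p(1-p) Σ_{k<N} P(|E(C(x))| ≥ k+1)`;
* `TwoGhostTail.lintegral_weight_le_sum` — summation by parts against a general partial-sum bound;
* `TwoGhostTail.lintegral_F4_sq_le_sum` — `(E F)² ≤ p(1-p) Σ_k min(1/n², 1/(k+1)²) P(|E(C(x))| ≥ k+1)`,
  where `F = 1(C(x) finite)·min(1/n, 1/|E(C(x))|)·|h_p(C(x))|` is the tree's Cauchy–Schwarz integrand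
  (`TwoGhost.F4`), through which `Σ_{e ∋ x} E[Tgt_e] ≤ (4d/p) E F` bounds the two-arm events at `x`;
* two elementary sums (`TwoGhostTail.sum_range_rpow_neg_le`, `TwoGhostTail.tsum_inv_sq_add_le`).

Part 2 (`PercMinContactMinContactExponentTwoGhostTail.lean`) sums the tail hypothesis
`P_p(|C(x)| ≥ m) ≤ A m^{-θ}` against the weights and concludes `P_p(𝒮_{e,n}) ≲ √A · n^{-(1+θ)/2}`.

References: T. Hutchcroft, Ann. Probab. 48 (2020), arXiv:1808.08940, §3 (Lemma 3.1, Thm. 1.6, Cor. 1.7)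
[Hutchcroft2020Locality]; T. Hutchcroft, Probab. Theory Relat. Fields 181 (2021), arXiv:2008.11197, Thm. 3.1
[Hutchcroft2021].
-/

noncomputable section

namespace Summit.CriticalPhenomena.PercolationContinuityZ3.Theorems

open MeasureTheory ProbabilityTheory Filter Literature.Probability.Percolation Literature.Probability.LatticeModels
open Literature.Probability.Percolation.TwoGhost
open scoped ENNReal Topology

namespace TwoGhostTail

/-! ## Not halted after `k` steps: the cluster touches at least `k + 1` edges -/

section NotHalted

variable {V : Type*} [DecidableEq V] {G : SimpleGraph V} [G.LocallyFinite] {c : ℕ}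

open Literature.Probability.Percolation.ClusterExploration in
/-- **If the exploration of `C(o)` (any vertex cap `c`) is not halted after `k` steps, then `C(o)`
touches at least `k + 1` edges of `G`**: the `k` queried edges are distinct edges of `G` at the active
set `⊆ C(o)`, and a non-halted state has one more, unqueried, boundary edge.
[cite: Hutchcroft2020Locality, §3, proof of Thm. 1.6 (`E Z_n² = p(1-p) E[T ∧ n]`, `T = |E(K_v)|`)] -/
theorem succ_le_encard_touch_of_not_halted (o : V) (ω : Set (Sym2 V)) (k : ℕ)
    (h : ¬ Halted G c (run G c o ω k)) :
    ((k + 1 : ℕ) : ℕ∞) ≤ (touch G (openCluster ω o)).encard := by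
  classical
  -- no earlier state is halted (halted states are absorbing)
  have hall : ∀ j < k, ¬ Halted G c (run G c o ω j) := fun j hj hH =>
    h (run_eq_of_halted hH k hj.le ▸ hH)
  have hlen : (run G c o ω k).hist.length = k := length_hist_run_of_forall_not_halted o ω k hall
  have hI := inv_run (G := G) (n := c) o ω k
  obtain ⟨b, hb⟩ : (boundary G (run G c o ω k)).Nonempty :=
    Finset.nonempty_iff_ne_empty.2 (not_or.1 h).2
  have hbq : b ∉ queried (run G c o ω k) := (mem_boundary_iff.1 hb).2
  have hsub : (↑(insert b (queried (run G c o ω k))) : Set (Sym2 V)) ⊆ touch G (openCluster ω o) := by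
    intro e he
    rw [Finset.coe_insert, Set.mem_insert_iff, Finset.mem_coe] at he
    rcases he with rfl | he
    · obtain ⟨⟨u, hu, v, huv, rfl⟩, -⟩ := mem_boundary_iff.1 hb
      exact mem_touch.2 ⟨(SimpleGraph.mem_edgeSet G).2 huv, u, Sym2.mem_mk_left u v,
        coe_A_subset_openCluster o ω k (Finset.mem_coe.2 hu)⟩
    · obtain ⟨hE, u, hu, hue⟩ := hI.queried_spec e he
      exact mem_touch.2 ⟨hE, u, hue, coe_A_subset_openCluster o ω k (Finset.mem_coe.2 hu)⟩
  calc ((k + 1 : ℕ) : ℕ∞) = ((insert b (queried (run G c o ω k))).card : ℕ∞) := by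
        rw [Finset.card_insert_of_notMem hbq, card_queried_run, hlen]
    _ = (↑(insert b (queried (run G c o ω k))) : Set (Sym2 V)).encard :=
        (Set.encard_coe_eq_coe_finsetCard _).symm
    _ ≤ _ := Set.encard_mono hsub

end NotHalted

/-! ## The refined second moment (Hutchcroft 2020, proof of Thm. 1.6, with `E[T ∧ N]` kept) -/

variable {d : ℕ}

/-- **`E[h_p(C(x))² ; C(x) finite, |E(C(x))| ≤ N] ≤ p(1-p) · Σ_{k<N} P_p(|E(C(x))| ≥ k+1)`** — the tree's
`TwoGhost.lintegral_sq_hp_le` with the exact second moment of the exploration score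
(`ClusterExploration.integral_score_sq_eq`: `E[Z_N²] = p(1-p) Σ_{k<N} P(not halted at k)`) and
`succ_le_encard_touch_of_not_halted` in place of `E[Z_N²] ≤ p(1-p)N`.
[cite: Hutchcroft2020Locality, §3, proof of Thm. 1.6 (`E Z_n² = p(1-p)E[T ∧ n]`)] -/
theorem lintegral_sq_hp_le_sum (p : unitInterval) (x : Site d) (N : ℕ) :
    ∫⁻ ω, {ω : BondConfig (Site d) | (openCluster ω x).Finite ∧ tE ω x ≤ N}.indicator
        (fun ω => ENNReal.ofReal ((hp p ω x) ^ 2)) ω ∂(bondPercolation (zdGraph d) p) ≤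
      ENNReal.ofReal (p * (1 - p)) * ∑ k ∈ Finset.range N,
        bondPercolation (zdGraph d) p {ω | ((k + 1 : ℕ) : ℕ∞) ≤ (touch (zdGraph d) (openCluster ω x)).encard} := by
  classical
  set P := bondPercolation (zdGraph d) p with hP
  set Z : BondConfig (Site d) → ℝ := fun ω =>
    ClusterExploration.score p (ClusterExploration.run (zdGraph d) (N + 2) x ω N) with hZ
  have hae : ∀ᵐ ω ∂P, ω ⊆ (zdGraph d).edgeSet := setBernoulli_ae_subset
  have hpt : ∀ᵐ ω ∂P, {ω : BondConfig (Site d) | (openCluster ω x).Finite ∧ tE ω x ≤ N}.indicator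
      (fun ω => ENNReal.ofReal ((hp p ω x) ^ 2)) ω ≤ ENNReal.ofReal ((Z ω) ^ 2) := by
    filter_upwards [hae] with ω hω
    by_cases hmem : ω ∈ {ω : BondConfig (Site d) | (openCluster ω x).Finite ∧ tE ω x ≤ N}
    · rw [Set.indicator_of_mem hmem]
      obtain ⟨hf, hN⟩ := hmem
      have hK : (↑hf.toFinset : Set (Site d)) = openCluster ω x := hf.coe_toFinset
      obtain ⟨h1, h2, h3, -⟩ := stats_eq_of_finite hK.symm
      have hcard : (edgesTouching (zdGraph d) hf.toFinset).card ≤ N := h1 ▸ hN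
      have hs := ClusterExploration.score_run_eq (G := zdGraph d) (n := N + 2) p x hω hK hcard le_rfl
      have : Z ω = -hp p ω x := by
        simp only [hZ, hs, hp, h2, h3]
        unfold TwoGhost.openEdges TwoGhost.closedEdges
        ring
      rw [this, neg_sq]
    · rw [Set.indicator_of_notMem hmem]; exact bot_le
  have hint : Integrable (fun ω => (Z ω) ^ 2) P :=
    ClusterExploration.integrable_comp_run (G := zdGraph d) (n := N + 2) p x N
      fun σ => (ClusterExploration.score p σ) ^ 2
  have hp0 : 0 ≤ (p : ℝ) := p.2.1
  have hp1 : (p : ℝ) ≤ 1 := p.2.2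
  have hpp : 0 ≤ (p : ℝ) * (1 - p) := mul_nonneg hp0 (sub_nonneg.2 hp1)
  -- `P(not halted at k) ≤ a_k`
  have hk : ∀ k, P.real {ω | ¬ ClusterExploration.Halted (zdGraph d) (N + 2)
      (ClusterExploration.run (zdGraph d) (N + 2) x ω k)} ≤
        (bondPercolation (zdGraph d) p {ω | ((k + 1 : ℕ) : ℕ∞) ≤ (touch (zdGraph d) (openCluster ω x)).encard}).toReal := by
    intro k
    rw [← measureReal_def]
    exact measureReal_mono (fun ω hω => succ_le_encard_touch_of_not_halted x ω k hω)
  calc ∫⁻ ω, {ω : BondConfig (Site d) | (openCluster ω x).Finite ∧ tE ω x ≤ N}.indicator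
        (fun ω => ENNReal.ofReal ((hp p ω x) ^ 2)) ω ∂P
      ≤ ∫⁻ ω, ENNReal.ofReal ((Z ω) ^ 2) ∂P := lintegral_mono_ae hpt
    _ = ENNReal.ofReal (∫ ω, (Z ω) ^ 2 ∂P) :=
        (ofReal_integral_eq_lintegral_ofReal hint (Eventually.of_forall fun ω => sq_nonneg _)).symm
    _ = ENNReal.ofReal ((p : ℝ) * (1 - p) * ∑ k ∈ Finset.range N, P.real {ω |
          ¬ ClusterExploration.Halted (zdGraph d) (N + 2) (ClusterExploration.run (zdGraph d) (N + 2) x ω k)}) := by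
        rw [ClusterExploration.integral_score_sq_eq (G := zdGraph d) (n := N + 2) p x N]
    _ ≤ ENNReal.ofReal ((p : ℝ) * (1 - p) * ∑ k ∈ Finset.range N,
          (bondPercolation (zdGraph d) p {ω | ((k + 1 : ℕ) : ℕ∞) ≤ (touch (zdGraph d) (openCluster ω x)).encard}).toReal) := by
        refine ENNReal.ofReal_le_ofReal (mul_le_mul_of_nonneg_left (Finset.sum_le_sum fun k _ => hk k) hpp)
    _ = ENNReal.ofReal (p * (1 - p)) * ∑ k ∈ Finset.range N,
          bondPercolation (zdGraph d) p {ω | ((k + 1 : ℕ) : ℕ∞) ≤ (touch (zdGraph d) (openCluster ω x)).encard} := by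
        rw [ENNReal.ofReal_mul hpp, ENNReal.ofReal_sum_of_nonneg (fun k _ => ENNReal.toReal_nonneg)]
        congr 1
        exact Finset.sum_congr rfl fun k _ => ENNReal.ofReal_toReal (measure_ne_top _ _)

/-! ## Summation by parts against a partial-sum bound, and the refined bound on `(E F)²` -/

/-- **Summation by parts** (generalising `TwoGhost.lintegral_weight_le`): if
`∫ 1(τ ≤ N)·X ≤ C · Σ_{k<N} b_k` for every `N`, then for an antitone weight `a → 0`,
`∫ a(τ)·X ≤ C · Σ_k a(k+1) b_k`. [cite: Hutchcroft2020Locality, §3, proof of Thm. 1.6 ((3.7)–(3.8))] -/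
theorem lintegral_weight_le_sum {Ω : Type*} [MeasurableSpace Ω] (μ : Measure Ω) {a : ℕ → ℝ≥0∞}
    (ha : Antitone a) (h0 : Tendsto a atTop (𝓝 0)) {X : Ω → ℝ≥0∞} (hX : Measurable X)
    {τ : Ω → ℕ} (hτ : Measurable τ) {C : ℝ≥0∞} {b : ℕ → ℝ≥0∞}
    (hC : ∀ N : ℕ, ∫⁻ ω, {ω | τ ω ≤ N}.indicator X ω ∂μ ≤ C * ∑ k ∈ Finset.range N, b k) :
    ∫⁻ ω, a (τ ω) * X ω ∂μ ≤ C * ∑' k, a (k + 1) * b k := by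
  classical
  set δ : ℕ → ℝ≥0∞ := fun N => a N - a (N + 1) with hδ
  -- `a (τ ω) = Σ_N 1(τ ω ≤ N) δ_N`
  have hrep : ∀ ω, a (τ ω) * X ω = ∑' N, {ω | τ ω ≤ N}.indicator (fun ω => δ N * X ω) ω := by
    intro ω
    have h := tsum_sub_succ_of_antitone ha h0 (τ ω)
    rw [← h, ← tsum_ite_le_eq (fun N => a N - a (N + 1)) (τ ω), ← ENNReal.tsum_mul_right]
    refine tsum_congr fun N => ?_
    by_cases hN : τ ω ≤ N
    · rw [if_pos hN, Set.indicator_of_mem (show ω ∈ {ω | τ ω ≤ N} from hN)]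
    · rw [if_neg hN, Set.indicator_of_notMem (show ω ∉ {ω | τ ω ≤ N} from hN), zero_mul]
  have hmeas : ∀ N, MeasurableSet {ω | τ ω ≤ N} := fun N => hτ measurableSet_Iic
  -- exchange of summation: `Σ_N δ_N Σ_{k<N} b_k = Σ_k b_k a_{k+1}`
  have key : ∑' N, δ N * ∑ k ∈ Finset.range N, b k = ∑' k, a (k + 1) * b k := by
    have h1 : ∀ N, δ N * ∑ k ∈ Finset.range N, b k = ∑' k, if k + 1 ≤ N then δ N * b k else 0 := by
      intro N
      rw [Finset.mul_sum, tsum_eq_sum (s := Finset.range N) (L := SummationFilter.unconditional _)]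
      · refine Finset.sum_congr rfl fun k hk => ?_
        rw [Finset.mem_range] at hk
        rw [if_pos (by omega)]
      · intro k hk
        rw [Finset.mem_range] at hk
        exact if_neg (by omega)
    simp_rw [h1]
    rw [ENNReal.tsum_comm]
    refine tsum_congr fun k => ?_
    have h2 : ∀ N, (if k + 1 ≤ N then δ N * b k else 0) = (if k + 1 ≤ N then δ N else 0) * b k := by
      intro N
      split_ifs <;> simp
    simp_rw [h2]
    rw [ENNReal.tsum_mul_right, tsum_ite_le_eq δ (k + 1)]
    congr 1
    have := tsum_sub_succ_of_antitone ha h0 (k + 1)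
    simpa [hδ, add_assoc] using this
  simp_rw [hrep]
  rw [lintegral_tsum fun N => ((hX.const_mul (δ N)).indicator (hmeas N)).aemeasurable]
  calc ∑' N, ∫⁻ ω, {ω | τ ω ≤ N}.indicator (fun ω => δ N * X ω) ω ∂μ
      = ∑' N, δ N * ∫⁻ ω, {ω | τ ω ≤ N}.indicator X ω ∂μ := by
        refine tsum_congr fun N => ?_
        rw [← lintegral_const_mul _ (hX.indicator (hmeas N))]
        refine lintegral_congr fun ω => ?_
        by_cases hN : ω ∈ {ω | τ ω ≤ N}
        · simp [Set.indicator_of_mem hN]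
        · simp [Set.indicator_of_notMem hN]
    _ ≤ ∑' N, δ N * (C * ∑ k ∈ Finset.range N, b k) := ENNReal.tsum_le_tsum fun N => mul_le_mul' le_rfl (hC N)
    _ = C * ∑' N, δ N * ∑ k ∈ Finset.range N, b k := by
        rw [← ENNReal.tsum_mul_left]
        exact tsum_congr fun N => by rw [mul_left_comm]
    _ = C * ∑' k, a (k + 1) * b k := by rw [key]

open Classical in
/-- **`(E F)² ≤ p(1-p) · Σ_k min(1/n², 1/(k+1)²) · P_p(|E(C(x))| ≥ k+1)`** — the tree's
`TwoGhost.lintegral_F4_sq_le` (Cauchy–Schwarz and summation by parts) run on the refined second moment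
`lintegral_sq_hp_le_sum`; the one-arm probabilities are kept instead of being bounded by `1`.
[cite: Hutchcroft2020Locality, §3, proof of Thm. 1.6 ((3.7)–(3.8))] -/
theorem lintegral_F4_sq_le_sum (n : ℕ) (p : unitInterval) (x : Site d) :
    (∫⁻ ω, F4 n p ω x ∂(bondPercolation (zdGraph d) p)) ^ 2 ≤
      ENNReal.ofReal (p * (1 - p)) * ∑' k, awt n (k + 1) *
        bondPercolation (zdGraph d) p {ω | ((k + 1 : ℕ) : ℕ∞) ≤ (touch (zdGraph d) (openCluster ω x)).encard} := by
  classical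
  set P := bondPercolation (zdGraph d) p with hP
  set τ : BondConfig (Site d) → ℕ := fun ω => if (openCluster ω x).Finite then tE ω x else 0 with hτ
  set X : BondConfig (Site d) → ℝ≥0∞ := fun ω =>
    if (openCluster ω x).Finite then ENNReal.ofReal ((hp p ω x) ^ 2) else 0 with hX
  have hτm : Measurable τ := measurable_finStats (d := d) x (c := (0 : ℕ)) fun t _ _ _ => t
  have hXm : Measurable X :=
    measurable_finStats (d := d) x (c := (0 : ℝ≥0∞)) fun _ nop ncl _ => ENNReal.ofReal ((p * ncl - (1 - p) * nop) ^ 2)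
  have hsq : ∀ ω, F4 n p ω x ^ 2 = awt n (τ ω) * X ω := by
    intro ω
    by_cases hf : (openCluster ω x).Finite
    · simp only [F4, hτ, hX, if_pos hf]
      rw [mul_pow, bwt_sq, ← ENNReal.ofReal_pow (abs_nonneg _), sq_abs]
    · simp only [F4, hτ, hX, if_neg hf]; simp
  have hC : ∀ N : ℕ, ∫⁻ ω, {ω | τ ω ≤ N}.indicator X ω ∂P ≤
      ENNReal.ofReal (p * (1 - p)) * ∑ k ∈ Finset.range N,
        bondPercolation (zdGraph d) p {ω | ((k + 1 : ℕ) : ℕ∞) ≤ (touch (zdGraph d) (openCluster ω x)).encard} := by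
    intro N
    have heq : ∀ ω, {ω | τ ω ≤ N}.indicator X ω =
        {ω : BondConfig (Site d) | (openCluster ω x).Finite ∧ tE ω x ≤ N}.indicator
          (fun ω => ENNReal.ofReal ((hp p ω x) ^ 2)) ω := by
      intro ω
      by_cases hf : (openCluster ω x).Finite
      · by_cases hN : tE ω x ≤ N
        · rw [Set.indicator_of_mem (show ω ∈ {ω | τ ω ≤ N} by simp [hτ, hf, hN]),
            Set.indicator_of_mem (show ω ∈ {ω : BondConfig (Site d) | (openCluster ω x).Finite ∧ tE ω x ≤ N}
              from ⟨hf, hN⟩)]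
          simp [hX, hf]
        · rw [Set.indicator_of_notMem (show ω ∉ {ω | τ ω ≤ N} by simp [hτ, hf, hN]),
            Set.indicator_of_notMem (show ω ∉ {ω : BondConfig (Site d) | (openCluster ω x).Finite ∧ tE ω x ≤ N}
              from fun h => hN h.2)]
      · have : X ω = 0 := by simp [hX, hf]
        rw [Set.indicator_of_notMem (show ω ∉ {ω : BondConfig (Site d) | (openCluster ω x).Finite ∧ tE ω x ≤ N}
          from fun h => hf h.1)]
        by_cases hm : ω ∈ {ω | τ ω ≤ N}
        · rw [Set.indicator_of_mem hm, this]
        · rw [Set.indicator_of_notMem hm]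
    calc ∫⁻ ω, {ω | τ ω ≤ N}.indicator X ω ∂P
        = ∫⁻ ω, {ω : BondConfig (Site d) | (openCluster ω x).Finite ∧ tE ω x ≤ N}.indicator
            (fun ω => ENNReal.ofReal ((hp p ω x) ^ 2)) ω ∂P := lintegral_congr heq
      _ ≤ ENNReal.ofReal (p * (1 - p)) * ∑ k ∈ Finset.range N,
          bondPercolation (zdGraph d) p {ω | ((k + 1 : ℕ) : ℕ∞) ≤ (touch (zdGraph d) (openCluster ω x)).encard} :=
        lintegral_sq_hp_le_sum p x N
  calc (∫⁻ ω, F4 n p ω x ∂P) ^ 2 ≤ ∫⁻ ω, F4 n p ω x ^ 2 ∂P := lintegral_sq_le P (measurable_F4 n p x).aemeasurable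
    _ = ∫⁻ ω, awt n (τ ω) * X ω ∂P := lintegral_congr hsq
    _ ≤ ENNReal.ofReal (p * (1 - p)) * ∑' t, awt n (t + 1) *
          bondPercolation (zdGraph d) p {ω | ((t + 1 : ℕ) : ℕ∞) ≤ (touch (zdGraph d) (openCluster ω x)).encard} :=
        lintegral_weight_le_sum P (awt_antitone n) (awt_tendsto_zero n) hXm hτm hC

/-! ## Elementary sums -/

/-- `Σ_{k<n} (k+1)^{-θ} ≤ n^{1-θ}/(1-θ)` for `0 ≤ θ < 1` and `n ≥ 1` (integral comparison). [folklore] -/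
theorem sum_range_rpow_neg_le {θ : ℝ} (hθ0 : 0 ≤ θ) (hθ1 : θ < 1) {n : ℕ} (hn : 1 ≤ n) :
    ∑ k ∈ Finset.range n, ((k + 1 : ℕ) : ℝ) ^ (-θ) ≤ (n : ℝ) ^ (1 - θ) / (1 - θ) := by
  have h1θ : 0 < 1 - θ := by linarith
  have hsplit : ∑ k ∈ Finset.range n, ((k + 1 : ℕ) : ℝ) ^ (-θ) =
      1 + ∑ i ∈ Finset.Ico 1 n, ((i + 1 : ℕ) : ℝ) ^ (-θ) := by
    rw [Finset.range_eq_Ico, ← Finset.sum_Ico_consecutive _ (Nat.zero_le 1) hn]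
    simp
  have hanti : AntitoneOn (fun x : ℝ => x ^ (-θ)) (Set.Icc ((1 : ℕ) : ℝ) ((n : ℕ) : ℝ)) := by
    intro a ha b _ hab
    have ha0 : 0 < a := lt_of_lt_of_le (by norm_num) ha.1
    exact Real.rpow_le_rpow_of_nonpos ha0 hab (by linarith)
  have hint := AntitoneOn.sum_le_integral_Ico hn hanti
  have hval : ∫ x in ((1 : ℕ) : ℝ)..((n : ℕ) : ℝ), x ^ (-θ) = ((n : ℝ) ^ (1 - θ) - 1) / (1 - θ) := by
    rw [integral_rpow (Or.inl (by linarith))]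
    simp only [Nat.cast_one, Real.one_rpow, show -θ + 1 = 1 - θ by ring]
  have hkey : ∑ i ∈ Finset.Ico 1 n, ((i + 1 : ℕ) : ℝ) ^ (-θ) ≤ ((n : ℝ) ^ (1 - θ) - 1) / (1 - θ) :=
    hint.trans_eq hval
  have heq : (1 : ℝ) + ((n : ℝ) ^ (1 - θ) - 1) / (1 - θ) = ((n : ℝ) ^ (1 - θ) - θ) / (1 - θ) := by
    field_simp
    ring
  calc ∑ k ∈ Finset.range n, ((k + 1 : ℕ) : ℝ) ^ (-θ)
      = 1 + ∑ i ∈ Finset.Ico 1 n, ((i + 1 : ℕ) : ℝ) ^ (-θ) := hsplit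
    _ ≤ 1 + ((n : ℝ) ^ (1 - θ) - 1) / (1 - θ) := by linarith
    _ = ((n : ℝ) ^ (1 - θ) - θ) / (1 - θ) := heq
    _ ≤ (n : ℝ) ^ (1 - θ) / (1 - θ) := div_le_div_of_nonneg_right (by linarith) h1θ.le

/-- `Σ_{j ≥ 0} 1/(j+n+1)² ≤ 1/n` in `ℝ≥0∞` (`n ≥ 1`; telescoping `1/(m+1)² ≤ 1/m - 1/(m+1)`). [folklore] -/
theorem tsum_inv_sq_add_le {n : ℕ} (hn : 1 ≤ n) :
    ∑' j : ℕ, ((j + n + 1 : ℕ) : ℝ≥0∞)⁻¹ ^ 2 ≤ (n : ℝ≥0∞)⁻¹ := by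
  have htel := tsum_sub_succ_of_antitone (a := fun m : ℕ => (m : ℝ≥0∞)⁻¹)
    (fun i j hij => ENNReal.inv_le_inv.2 (by exact_mod_cast hij)) ENNReal.tendsto_inv_nat_nhds_zero n
  rw [← htel]
  refine ENNReal.tsum_le_tsum fun k => ?_
  have := inv_succ_sq_le_sub (m := n + k) (by omega)
  rw [show k + n + 1 = n + k + 1 by omega]
  exact this

end TwoGhostTail

/-- **Registered sub-goal `twoGhostTail_sqMoment` of stub A (`stub_condTwoGhost`)** — the refined second
moment of the boundary fluctuation `h_p(C(x)) = p·#closed − (1−p)·#open` over the edges touching `C(x)`: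
for every `d`, level `p`, site `x` and `N`,
`E[h_p(C(x))² ; C(x) finite, |E(C(x))| ≤ N] ≤ p(1-p) · Σ_{k<N} P_p(|E(C(x))| ≥ k+1)`
(closed form of `TwoGhostTail.lintegral_sq_hp_le_sum`; Hutchcroft's `E Z_N² = p(1-p) E[T ∧ N]` with the
one-arm tail kept). [cite: Hutchcroft2020Locality, §3, proof of Thm. 1.6] -/
theorem twoGhostTail_sqMoment : ∀ (d : ℕ) (p : unitInterval) (x : Site d) (N : ℕ), ∫⁻ ω, {ω : BondConfig (Site d) | (openCluster ω x).Finite ∧ TwoGhost.tE ω x ≤ N}.indicator (fun ω => ENNReal.ofReal ((TwoGhost.hp p ω x) ^ 2)) ω ∂(bondPercolation (zdGraph d) p) ≤ ENNReal.ofReal (p * (1 - p)) * ∑ k ∈ Finset.range N, bondPercolation (zdGraph d) p {ω | ((k + 1 : ℕ) : ℕ∞) ≤ (TwoGhost.touch (zdGraph d) (openCluster ω x)).encard} :=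
  fun _ p x N => TwoGhostTail.lintegral_sq_hp_le_sum p x N

end Summit.CriticalPhenomena.PercolationContinuityZ3.Theorems

end
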